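import Mathlib
import HarnessLib
import Summits.HubbardSuperconductivity.HubbardSuperconductivity.Theorems.KLProgrammeKLRegimeEngineScaleOnePartitionFn

/-!
# Route `KLProgramme` — crux K3 ENGINE (stmt-HubbardSuperconductivity-20437 `KLRegimeEngineV17F2`), stub (b) v2, THE LEVELS PACKAGE (ℓ):
# `Z^K_{Λ_1} ≠ 0` WITH A c-UNIFORM U-DOOR (cell gate-hubbard-kl, seat gate-hubbard-kl-p3 g22; variant of `exists_partitionFn_scaleOne_ne_zero`
# (…ScaleOnePartitionFn, p686893) for composition into the ∀-prefix of the (ℓ) assembly)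

`exists_partitionFn_scaleOne_ne_zero` states its U-door as `∀ c ≤ c₀, ∃ U₀ > 0, ∀ U ≤ U₀` with `U₀ = min (klEngU₀6 P R c) (explicit R-constant)`.  With the
assembly's binder `U ≤ klEngU₀9 P R c ≤ klEngU₀6 P R c` (`klEngU₀9_le_klEngU₀6`) the remaining door is ONE c-free constant:

* **`exists_partitionFn_scaleOne_ne_zero_unif (P R)`** — `∃ c₀ > 0, ∃ U₀ > 0, ∀ c, 0 < c ≤ c₀ → ∀ μ ∈ klWindowC, ∀ U, 0 < U → U ≤ klEngU₀9 P R c → U ≤ U₀ →`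
  regime, volumes, every `FrameOK` frame ⇒ `hubbardEffPartitionFnCT L M β U μ 0 K (klScale klE0 1) ≠ 0`.  Proof = p686893's verbatim with the two door lines changed.
Composition of landed theorems; nothing about the model is asserted beyond them; nothing asserts (ℓ), any stub, K3 or superconductivity.
References: BGM 2006 §2.7 (2.77)–(2.81) [cite: BenfattoGiulianiMastropietro2006].
-/

noncomputable section

namespace Summit.HubbardSuperconductivity.HubbardSuperconductivity.Theorems.EngineV8

set_option linter.dupNamespace false -- summit = problem name (single-conjunct summit), D-0017

open Real Finset Literature.MathematicalPhysics.QuantumLattice Literature.Probability.LatticeModels Literature.Probability.LatticeModels.BattleFederbush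
open Summit.HubbardSuperconductivity.HubbardSuperconductivity.Theorems.KLRegimeSplit
open Summit.HubbardSuperconductivity.HubbardSuperconductivity.Theorems.KLProgrammeLegKernels
open Summit.HubbardSuperconductivity.HubbardSuperconductivity.Theorems.ScaleZeroDecay

variable {L M : ℕ} [NeZero L] [NeZero M]


/-- **`Z^K_{Λ₁} ≠ 0` for every admissible frame, PACKAGED with the level-`0` doors, c-UNIFORM U-DOOR** (variant of `exists_partitionFn_scaleOne_ne_zero`) (the same door construction as
`exists_srcPinnedSumW_one_klSrcBudget`: `Ā := D₁·(1+ΣGfr)⁴`, `k̄K := klE4KapF R·|U| + 2(c/log 4)·klE4Mom R`, product doors on `c` and `U`).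
[cite: BenfattoGiulianiMastropietro2006, §2.7 (2.77)–(2.81)] -/
theorem exists_partitionFn_scaleOne_ne_zero_unif (P : SplitConsts) (R : RenConsts) (hR : R.WF2) :
    ∃ c₀ : ℝ, 0 < c₀ ∧ ∃ U₀ : ℝ, 0 < U₀ ∧ ∀ c : ℝ, 0 < c → c ≤ c₀ →
      ∀ μ ∈ klWindowC, ∀ U : ℝ, 0 < U → U ≤ klEngU₀9 P R c → U ≤ U₀ → ∀ β : ℝ, klBetaMin ≤ β → β ≤ Real.exp (c / U ^ 2) →
        ∀ (L M : ℕ) [NeZero L] [NeZero M], klEngL₃ β U ≤ L → klEngM₃ β U L ≤ M →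
          ∀ K : TrigPolyC4v, FrameOK R U (nScales β) μ K → hubbardEffPartitionFnCT L M β U μ 0 K (klScale klE0 1) ≠ 0 := by
  obtain ⟨D₁, hD₁, hbr⟩ := exists_abarOne_le
  have hRwf : R.WF := hR.wf
  have hG : ∀ j, 0 ≤ R.Gfr j := hRwf.2.2
  have he1 : 1 ≤ Real.exp 1 := Real.one_le_exp (by norm_num)
  have h4 : 0 < Real.log 4 := Real.log_pos (by norm_num)
  have hKF := one_le_klE4KapF R
  set g : ℝ := (1 + R.Gfr 0 + R.Gfr 1 + R.Gfr 2 + R.Gfr 3) ^ 4 with hg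
  have hg1 : 1 ≤ g := by
    rw [hg]
    have : (1 : ℝ) ≤ 1 + R.Gfr 0 + R.Gfr 1 + R.Gfr 2 + R.Gfr 3 := by linarith [hG 0, hG 1, hG 2, hG 3]
    exact one_le_pow₀ this
  set Abar : ℝ := D₁ * g with hAbarD
  have hAbar1 : 1 ≤ Abar := one_le_mul_of_one_le_of_one_le hD₁ hg1
  have hAbarpos : 0 < Abar := lt_of_lt_of_le one_pos hAbar1
  set κ₁ : ℝ := Real.sqrt (2 * (7 + 6047)) + Real.sqrt 6047 with hκ₁
  have hκ₁1 : 1 ≤ κ₁ ^ 2 := by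
    have h1 : (1 : ℝ) ≤ Real.sqrt (2 * (7 + 6047)) := by
      rw [show (1 : ℝ) = Real.sqrt 1 by simp]; exact Real.sqrt_le_sqrt (by norm_num)
    have h2 : 0 ≤ Real.sqrt 6047 := Real.sqrt_nonneg _
    have h3 : (1 : ℝ) ≤ κ₁ := by rw [hκ₁]; linarith
    exact one_le_pow₀ h3
  have hκ₁pos : 0 < κ₁ := by
    rw [hκ₁]; exact add_pos_of_pos_of_nonneg (Real.sqrt_pos.2 (by norm_num)) (Real.sqrt_nonneg _)
  have hKFpos : 0 < klE4KapF R := lt_of_lt_of_le one_pos hKF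
  have hMom1 : 0 < klE4Mom R + 1 := by have := klE4Mom_nonneg R; linarith
  -- the c-door
  refine ⟨min (klEngC₃6 P R) (Real.log 4 / (128 * Real.exp 1 ^ 5 * Abar * (klE4Mom R + 1))), lt_min (klEngC₃6_pos P R) (by positivity),
    1 / (128 * Real.exp 1 ^ 9 * κ₁ ^ 2 * Abar * klE4KapF R), by positivity, fun c hc hcc₀ => ?_⟩
  have hc₆ : c ≤ klEngC₃6 P R := hcc₀.trans (min_le_left _ _)
  have hcd' : c ≤ Real.log 4 / (128 * Real.exp 1 ^ 5 * Abar * (klE4Mom R + 1)) := hcc₀.trans (min_le_right _ _)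
  have hcd : 128 * Real.exp 1 ^ 5 * Abar * (klE4Mom R + 1) * (c / Real.log 4) ≤ 1 := by
    have hden : 0 < 128 * Real.exp 1 ^ 5 * Abar * (klE4Mom R + 1) := by positivity
    rw [le_div_iff₀ hden] at hcd'
    rw [show 128 * Real.exp 1 ^ 5 * Abar * (klE4Mom R + 1) * (c / Real.log 4) =
      128 * Real.exp 1 ^ 5 * Abar * (klE4Mom R + 1) * c / Real.log 4 by ring, div_le_one h4]
    linarith
  -- the U-door
  intro μ hμ U hU hU9 hUd' β hβ hβc L M _ _ hL hM K hK
  have hU₆ : U ≤ klEngU₀6 P R c := hU9.trans (klEngU₀9_le_klEngU₀6 P R c)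
  have hUd : 128 * Real.exp 1 ^ 9 * κ₁ ^ 2 * Abar * klE4KapF R * U ≤ 1 := by
    have hden : 0 < 128 * Real.exp 1 ^ 9 * κ₁ ^ 2 * Abar * klE4KapF R := by positivity
    rw [le_div_iff₀ hden] at hUd'; linarith
  obtain ⟨hθ1, hθ2⟩ := thetaW_smallness_of_le (cl := c / Real.log 4) he1 hκ₁1 hAbarpos.le hKF hU (div_nonneg hc.le h4.le) hUd hcd
  have hU₀3 : U ≤ klEngU₀3 P R c := hU₆.trans (klEngU₀6_le_klEngU₀3 P R c)
  have hU1 : |U| ≤ 1 := abs_le_one_of_le_klEngU₀3 hU hU₀3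
  have hcD : c ≤ klE4C₃ R := hc₆.trans (klEngC₃6_le_klE4C₃ P R)
  have hN := nScales_succ_mul_sq_le (U := U) hc.le hβ hβc
  have hhalf := div_log_four_le_half_of_door hcD
  have hAbar := (hbr R U (nScales β) hRwf hU1 (hN.trans hhalf)).trans (le_of_eq hAbarD.symm)
  exact partitionFn_scaleOne_ne_zero_of_bounds hK hRwf hU hU1 hβ hL hM hAbarpos hAbar
    (kKbar := klE4KapF R * |U| + 2 * (c / Real.log 4) * klE4Mom R) (kKbar_le hRwf hN) hθ1 hθ2

end Summit.HubbardSuperconductivity.HubbardSuperconductivity.Theorems.EngineV8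

end
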